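import Mathlib
import HarnessLib

/-!
# The signed Hurwitz action on words of classes, and its Picard–Lefschetz shadow

The braid group `B_n` acts on length-`n` tuples in any group by HURWITZ MOVES
`(…, a, b, …) ↦ (…, a b a⁻¹, a, …)` and their inverses (standard; e.g. [GompfStipsiczGSM1999,
§8.1–§8.2] for tuples of Dehn twists = monodromy factorisations of Lefschetz fibrations, where the
moves are the elementary changes of a Hurwitz arc system).  For a (possibly achiral) Lefschetz
fibration with fibre `F` the homological shadow of a Dehn twist `t_v^{ε}` (`ε = ±1` the chirality
of the critical point) is the signed TRANSVECTION `x ↦ x + ε·Bf(v,x)·v` of `H₁(F)` for the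
intersection pairing `Bf` (Picard–Lefschetz formula), and the shadow of a Hurwitz move is
`(a,ε)(b,ε') ↦ (b + ε·Bf(a,b)·a, ε')(a,ε)`.  This file records that purely algebraic calculus on
SIGNED WORDS `List (V × Bool)` over a module `V` with a bilinear pairing `Bf : V →ₗ V →ₗ R`
(`true` = positive letter): `HurwitzStep`, `HurwitzOrbit`, `transvection`, `wordProduct` (signed
monodromy), `letters`, `classesOfSign`, `Sorted` (positive letters first), `OmegaConnected`
(irreducibility of a letter set), `mapWord` (§1); the standard symplectic lattice `stdSymp`
(`H₁(F_{g,1})` in a symplectic basis) and the coefficient changes `redWord` (mod `p`) / `ratWord`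
(to `ℚ`) (§2); bookkeeping lemmas (§3).  Everything is a definition or a proved `simp`-level lemma;
nothing is asserted.

Used by: the sorting lines of crux `ConvexBisection.AcyclicBisectionExists`
(stmt-SmoothPoincare4-10508; checked skeleton `Summits/SmoothPoincare4/SmoothPoincare4/Cruxes/
AcyclicBisectionExists/Lines/modp-braid-orbits.lean`), whose registered stubs are stated in exactly
this vocabulary.  Deliberately NOT here: mapping-class groups, Lefschetz fibrations, or any claim
that the algebraic orbit is realised geometrically (that is the dictionary stub of the skeleton).
Design choice: words are plain lists of pairs (no dependent types), so that coefficient changes and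
Hurwitz moves commute letter by letter; the pairing is arbitrary (the applications specialise to
`stdSymp`, which is alternating, whence transvections preserve it and Hurwitz moves preserve
`wordProduct`).
-/

noncomputable section

namespace Literature.GroupTheory.CombinatorialGroupTheory.SignedHurwitz

/-! ## §1 Signed words, signed Hurwitz moves, signed monodromy -/

section Words

variable {R : Type*} [CommRing R] {V W : Type*} [AddCommGroup V] [Module R V]

/-- The sign of a letter as a ring element (`true` = positive Dehn twist / transvection `↦ 1`,
`false ↦ -1`). [folklore] -/
def sgn (b : Bool) : R := if b then 1 else -1

/-- One signed homological HURWITZ MOVE for the pairing `Bf` (the intersection form on `H₁(F)`),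
at any position of the word: `(a,ε)(b,ε') ↦ (b + ε·Bf(a,b)·a, ε')(a,ε)` (shadow of
`t_a^ε t_b^{ε'} = t^{ε'}_{t_a^ε b} t_a^ε`) or its inverse `(a,ε)(b,ε') ↦ (b,ε')(a − ε'·Bf(b,a)·b, ε)`.
Signs travel with letters. [folklore] -/
def HurwitzStep (Bf : V →ₗ[R] V →ₗ[R] R) (l l' : List (V × Bool)) : Prop :=
  ∃ (pre suf : List (V × Bool)) (a b : V × Bool), l = pre ++ a :: b :: suf ∧
    (l' = pre ++ (b.1 + (sgn a.2 * Bf a.1 b.1) • a.1, b.2) :: a :: suf ∨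
     l' = pre ++ b :: (a.1 - (sgn b.2 * Bf b.1 a.1) • b.1, a.2) :: suf)

/-- The signed HURWITZ ORBIT relation: the reflexive–transitive closure of `HurwitzStep` (the braid
group `B_n` acting on signed words of length `n`). [folklore] -/
def HurwitzOrbit (Bf : V →ₗ[R] V →ₗ[R] R) : List (V × Bool) → List (V × Bool) → Prop :=
  Relation.ReflTransGen (HurwitzStep Bf)

/-- All classes occurring in a signed word. [folklore] -/
def letters (l : List (V × Bool)) : Set V := {v | ∃ s : Bool, (v, s) ∈ l}

/-- The classes carried by the letters of sign `s`. [folklore] -/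
def classesOfSign (l : List (V × Bool)) (s : Bool) : Set V := {v | (v, s) ∈ l}

/-- SORTED words: all positive letters come first. [folklore] -/
def Sorted (l : List (V × Bool)) : Prop :=
  ∃ P N : List (V × Bool), l = P ++ N ∧ (∀ x ∈ P, x.2 = true) ∧ ∀ x ∈ N, x.2 = false

/-- The signed TRANSVECTION of a letter `(v, ε)`: `x ↦ x + ε·Bf(v,x)·v` (the action of the Dehn
twist `t_v^ε` on `H₁(F)`, Picard–Lefschetz). [folklore] -/
def transvection (Bf : V →ₗ[R] V →ₗ[R] R) (x : V × Bool) : Module.End R V :=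
  LinearMap.id + (sgn x.2 : R) • (Bf x.1).smulRight x.1

/-- The signed MONODROMY of a word: the product of its signed transvections, first letter
outermost (`wordProduct Bf (x :: l) = transvection Bf x * wordProduct Bf l`). [folklore] -/
def wordProduct (Bf : V →ₗ[R] V →ₗ[R] R) (l : List (V × Bool)) : Module.End R V :=
  (l.map (transvection Bf)).prod

/-- ω-CONNECTEDNESS of a set of classes (irreducibility of the letter set): no non-empty proper
subset is `Bf`-orthogonal to its complement. [folklore] -/
def OmegaConnected (Bf : V →ₗ[R] V →ₗ[R] R) (S : Set V) : Prop :=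
  ∀ T ⊆ S, T.Nonempty → T ≠ S → ∃ v ∈ T, ∃ w ∈ S \ T, Bf v w ≠ 0

/-- Change of coefficients on the classes of a word (signs kept). [folklore] -/
def mapWord (φ : V → W) (l : List (V × Bool)) : List (W × Bool) :=
  l.map fun x => (φ x.1, x.2)

end Words

/-! ## §2 The standard symplectic lattice `R^g ⊕ R^g = H₁(F_{g,1}; R)` and coefficient changes -/

section Standard

variable (R : Type*) [CommRing R]

/-- The standard symplectic pairing on `R^g ⊕ R^g` (Gram matrix `[[0, 1], [-1, 0]]` in `g × g`
blocks): the intersection form of the genus-`g` surface with one boundary circle in a symplectic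
basis. [folklore] -/
def stdSymp (g : ℕ) : (Fin g ⊕ Fin g → R) →ₗ[R] (Fin g ⊕ Fin g → R) →ₗ[R] R :=
  Matrix.toLinearMap₂' R (Matrix.fromBlocks 0 1 (-1) 0)

/-- Reduction of an integral word modulo `p` (coordinatewise `ℤ → ZMod p`, signs kept). [folklore] -/
def redWord (p : ℕ) {g : ℕ} (l : List ((Fin g ⊕ Fin g → ℤ) × Bool)) :
    List ((Fin g ⊕ Fin g → ZMod p) × Bool) :=
  mapWord (fun v i => (v i : ZMod p)) l

/-- An integral word read over `ℚ` (coordinatewise `ℤ → ℚ`, signs kept). [folklore] -/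
def ratWord {g : ℕ} (l : List ((Fin g ⊕ Fin g → ℤ) × Bool)) : List ((Fin g ⊕ Fin g → ℚ) × Bool) :=
  mapWord (fun v i => (v i : ℚ)) l

end Standard

/-! ## §3 Bookkeeping lemmas -/

section LemmasLinear

variable {R : Type*} [CommRing R] {V : Type*} [AddCommGroup V] [Module R V]

/-- `sgn true = 1`. [folklore] -/
@[simp] theorem sgn_true : (sgn true : R) = 1 := rfl

/-- `sgn false = -1`. [folklore] -/
@[simp] theorem sgn_false : (sgn false : R) = -1 := rfl

/-- The Hurwitz orbit relation is reflexive. [folklore] -/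
theorem HurwitzOrbit.refl (Bf : V →ₗ[R] V →ₗ[R] R) (l : List (V × Bool)) : HurwitzOrbit Bf l l :=
  Relation.ReflTransGen.refl

/-- The Hurwitz orbit relation is transitive. [folklore] -/
theorem HurwitzOrbit.trans {Bf : V →ₗ[R] V →ₗ[R] R} {l₁ l₂ l₃ : List (V × Bool)}
    (h₁ : HurwitzOrbit Bf l₁ l₂) (h₂ : HurwitzOrbit Bf l₂ l₃) : HurwitzOrbit Bf l₁ l₃ :=
  Relation.ReflTransGen.trans h₁ h₂

/-- One Hurwitz step lies in the orbit. [folklore] -/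
theorem HurwitzStep.orbit {Bf : V →ₗ[R] V →ₗ[R] R} {l l' : List (V × Bool)}
    (h : HurwitzStep Bf l l') : HurwitzOrbit Bf l l' :=
  Relation.ReflTransGen.single h

/-- The signed transvection, evaluated. [folklore] -/
theorem transvection_apply (Bf : V →ₗ[R] V →ₗ[R] R) (x : V × Bool) (y : V) :
    transvection Bf x y = y + (sgn x.2 * Bf x.1 y) • x.1 := by
  simp [transvection, mul_smul]

/-- The monodromy of the empty word is the identity. [folklore] -/
@[simp] theorem wordProduct_nil (Bf : V →ₗ[R] V →ₗ[R] R) : wordProduct Bf ([] : List (V × Bool)) = 1 :=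
  rfl

/-- The monodromy of `x :: l` is `t_x ∘ (monodromy of l)`. [folklore] -/
@[simp] theorem wordProduct_cons (Bf : V →ₗ[R] V →ₗ[R] R) (x : V × Bool) (l : List (V × Bool)) :
    wordProduct Bf (x :: l) = transvection Bf x * wordProduct Bf l := by
  simp [wordProduct]

/-- The monodromy of a concatenation is the composite of the monodromies. [folklore] -/
theorem wordProduct_append (Bf : V →ₗ[R] V →ₗ[R] R) (l l' : List (V × Bool)) :
    wordProduct Bf (l ++ l') = wordProduct Bf l * wordProduct Bf l' := by
  simp [wordProduct, List.prod_append]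

end LemmasLinear

section LemmasWords

variable {V W : Type*}

/-- Letters of a concatenation. [folklore] -/
theorem letters_append (l l' : List (V × Bool)) : letters (l ++ l') = letters l ∪ letters l' := by
  ext v
  simp only [letters, List.mem_append, Set.mem_setOf_eq, Set.mem_union]
  constructor
  · rintro ⟨s, h | h⟩
    · exact Or.inl ⟨s, h⟩
    · exact Or.inr ⟨s, h⟩
  · rintro (⟨s, h⟩ | ⟨s, h⟩)
    · exact ⟨s, Or.inl h⟩
    · exact ⟨s, Or.inr h⟩

/-- The classes of a given sign are among the letters. [folklore] -/
theorem classesOfSign_subset_letters (l : List (V × Bool)) (s : Bool) : classesOfSign l s ⊆ letters l :=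
  fun _ hv => ⟨s, hv⟩

/-- Every letter has one of the two signs. [folklore] -/
theorem letters_eq_union (l : List (V × Bool)) :
    letters l = classesOfSign l true ∪ classesOfSign l false := by
  ext v
  simp only [letters, classesOfSign, Set.mem_setOf_eq, Set.mem_union]
  constructor
  · rintro ⟨s, h⟩
    cases s
    · exact Or.inr h
    · exact Or.inl h
  · rintro (h | h)
    · exact ⟨true, h⟩
    · exact ⟨false, h⟩

/-- `mapWord` distributes over concatenation. [folklore] -/
theorem mapWord_append (φ : V → W) (l l' : List (V × Bool)) :
    mapWord φ (l ++ l') = mapWord φ l ++ mapWord φ l' := by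
  simp [mapWord]

/-- `mapWord` on a cons. [folklore] -/
@[simp] theorem mapWord_cons (φ : V → W) (x : V × Bool) (l : List (V × Bool)) :
    mapWord φ (x :: l) = (φ x.1, x.2) :: mapWord φ l := rfl

/-- `mapWord` on the empty word. [folklore] -/
@[simp] theorem mapWord_nil (φ : V → W) : mapWord φ ([] : List (V × Bool)) = [] := rfl

/-- `mapWord` preserves length. [folklore] -/
theorem length_mapWord (φ : V → W) (l : List (V × Bool)) : (mapWord φ l).length = l.length := by
  simp [mapWord]

/-- `mapWord` preserves the number of positive letters. [folklore] -/
theorem length_filter_mapWord (φ : V → W) (l : List (V × Bool)) :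
    ((mapWord φ l).filter (·.2)).length = (l.filter (·.2)).length := by
  induction l with
  | nil => rfl
  | cons x l ih =>
    obtain ⟨v, b⟩ := x
    cases b <;> simp_all [mapWord]

/-- The letters of `mapWord φ l` are the `φ`-images of the letters of `l`. [folklore] -/
theorem letters_mapWord (φ : V → W) (l : List (V × Bool)) : letters (mapWord φ l) = φ '' letters l := by
  ext w
  simp only [letters, mapWord, List.mem_map, Prod.exists, Set.mem_setOf_eq, Set.mem_image]
  constructor
  · rintro ⟨s, v, s', h, he⟩
    obtain ⟨rfl, rfl⟩ := Prod.mk.injEq _ _ _ _ ▸ he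
    exact ⟨v, ⟨s', h⟩, rfl⟩
  · rintro ⟨v, ⟨s, h⟩, rfl⟩
    exact ⟨s, v, s, h, rfl⟩

/-- The classes of sign `s` of `mapWord φ l` are the `φ`-images of those of `l`. [folklore] -/
theorem classesOfSign_mapWord (φ : V → W) (l : List (V × Bool)) (s : Bool) :
    classesOfSign (mapWord φ l) s = φ '' classesOfSign l s := by
  ext w
  simp only [classesOfSign, mapWord, List.mem_map, Prod.exists, Set.mem_setOf_eq, Set.mem_image]
  constructor
  · rintro ⟨v, s', h, he⟩
    obtain ⟨rfl, rfl⟩ := Prod.mk.injEq _ _ _ _ ▸ he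
    exact ⟨v, h, rfl⟩
  · rintro ⟨v, h, rfl⟩
    exact ⟨v, s, h, rfl⟩

/-- A word whose image under `mapWord` is sorted is itself sorted (signs are kept). [folklore] -/
theorem Sorted.of_mapWord (φ : V → W) {l : List (V × Bool)} (h : Sorted (mapWord φ l)) : Sorted l := by
  obtain ⟨P, N, hPN, hP, hN⟩ := h
  obtain ⟨l₁, l₂, rfl, h₁, h₂⟩ := List.map_eq_append_iff.mp hPN
  refine ⟨l₁, l₂, rfl, fun x hx => ?_, fun x hx => ?_⟩
  · exact hP (φ x.1, x.2) (h₁ ▸ List.mem_map.mpr ⟨x, hx, rfl⟩)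
  · exact hN (φ x.1, x.2) (h₂ ▸ List.mem_map.mpr ⟨x, hx, rfl⟩)

/-- A sorted word stays sorted under `mapWord`. [folklore] -/
theorem Sorted.mapWord (φ : V → W) {l : List (V × Bool)} (h : Sorted l) : Sorted (mapWord φ l) := by
  obtain ⟨P, N, rfl, hP, hN⟩ := h
  refine ⟨SignedHurwitz.mapWord φ P, SignedHurwitz.mapWord φ N, mapWord_append φ P N, ?_, ?_⟩
  · intro x hx
    obtain ⟨y, hy, rfl⟩ := List.mem_map.mp hx
    exact hP y hy
  · intro x hx
    obtain ⟨y, hy, rfl⟩ := List.mem_map.mp hx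
    exact hN y hy

end LemmasWords

end Literature.GroupTheory.CombinatorialGroupTheory.SignedHurwitz

end
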